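import Summits.SmoothPoincare4.SmoothPoincare4.Theorems.SymplecticOrigamiGromovRecognitionRelEndGluedBasics
import Literature.Geometry.Symplectic.JHolomorphicLimitEmbeddedProofs
import Mathlib.Topology.UniformSpace.CompactConvergence

/-!
# Somewhere injective limits of embedded `J`-spheres are embedded — auxiliary lemmas
(registered helpers `helper_limitEmbeddedSpherePartnerClosed` and
`helper_limitEmbeddedSphereRegularPreconnected` of line `cross-cap-laurent`, crux `GromovRecognitionRelEnd`,
item stmt-SmoothPoincare4-11009; the elementary topology of the sphere version of McDuff's limit theorem,
`helper_limitEmbeddedSphere`, split off under the file-size cap)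

* `helper_limitEmbeddedSpherePartnerClosed` — **limits of partners are partners.**  For a continuous
  two-chart pair `(u, v)` (`v z = u z⁻¹` off `0`) which is injective on a disc about `t`, if parameters
  `tₖ → t` all have a PARTNER (another parameter `s ≠ tₖ` with `u s = u tₖ`, or the point at infinity,
  `v 0 = u tₖ`), then so does `t`: bounded partners subconverge to a partner distinct from `t` by the local
  injectivity, unbounded ones are inverted and subconverge near the origin of the chart at infinity.
* `helper_limitEmbeddedSphereRegularPreconnected` — **a subset of `ℂ` containing a punctured
  neighbourhood of every point of the plane is preconnected** (as soon as it is non-empty): its trace on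
  every closed disc misses only finitely many points, and a disc minus finitely many points is path
  connected (`Literature.Geometry.Symplectic.LimitEmbedded.isPathConnected_ball_diff_finite`).  Applied to
  the set of regular points of a `J`-holomorphic curve, whose critical points are isolated.
* `LimitEmbeddedSphere.tendstoUniformly_chart`, `LimitEmbeddedSphere.glued_apply_pt_one` — compact-open
  convergence of glued maps `ℂℙ¹ → X` read in an affine chart through a continuous `e : X → ℝᴺ`, and the
  value of a glued map on the chart at infinity.

References: D. McDuff, J. Differential Geom. 34 (1991), §4–§5; C. Wendl, *Holomorphic Curves in Low
Dimensions* (2018), Cor. 2.52.  No definitions, no named facts.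
-/

noncomputable section

open scoped Manifold ContDiff Topology
open Set Function Filter
open Literature.Topology.FourManifolds Literature.Topology.FourManifolds.ComplexProjectiveSpace
open Literature.Geometry.Symplectic Literature.Geometry.Symplectic.LimitEmbedded
open Summit.SmoothPoincare4.SmoothPoincare4.Theorems.GromovRecognitionRelEnd.CrossCapLaurent.GluedBasics

-- the prescribed namespace `Summit.<P>.<Sub>.…` duplicates `SmoothPoincare4` (P = Sub)
set_option linter.dupNamespace false

namespace Summit.SmoothPoincare4.SmoothPoincare4.Theorems.GromovRecognitionRelEnd.CrossCapLaurent

namespace LimitEmbeddedSphere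

variable {X : Type} [TopologicalSpace X]

/-- **Compact-open convergence of glued maps, read through a continuous `e : X → ℝᴺ` in the affine
chart `i`**: if `Gs k → F` in `C(ℂℙ¹, X)` then `e ∘ Gs k ∘ [homogenize i ·] → e ∘ F ∘ [homogenize i ·]`
uniformly on `ℂ` (`ℂℙ¹` is compact, so compact-open convergence is uniform convergence). [folklore] -/
theorem tendstoUniformly_chart {N : ℕ} {e : X → EuclideanSpace ℝ (Fin N)} (he : Continuous e)
    {Gs : ℕ → C(ComplexProjectiveSpace 1, X)} {F : C(ComplexProjectiveSpace 1, X)}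
    (hlim : Tendsto Gs atTop (𝓝 F)) (i : Fin (1 + 1)) :
    TendstoUniformly (fun k (z : ℂ) => e (Gs k (mk (homogenize i fun _ : Fin 1 => z))))
      (fun z => e (F (mk (homogenize i fun _ : Fin 1 => z)))) atTop := by
  set E : C(X, EuclideanSpace ℝ (Fin N)) := ⟨e, he⟩ with hE
  have h1 : Tendsto (fun k => E.comp (Gs k)) atTop (𝓝 (E.comp F)) :=
    ((ContinuousMap.continuous_postcomp E).tendsto F).comp hlim
  have h2 : TendstoUniformly (fun k => ⇑(E.comp (Gs k))) (E.comp F) atTop :=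
    ContinuousMap.tendsto_iff_tendstoUniformly.1 h1
  exact h2.comp fun z : ℂ => mk (homogenize i fun _ : Fin 1 => z)

omit [TopologicalSpace X] in
/-- A glued map takes the value `v w` at `[w : 1]`. [folklore] -/
theorem glued_apply_pt_one {v : ℂ → X} {F : ComplexProjectiveSpace 1 → X}
    (h1 : ∀ p, CoordNeZero 1 p → F p = v (affineCoordComplex 1 p 0)) (w : ℂ) :
    F (mk (homogenize 1 fun _ : Fin 1 => w)) = v w := by
  rw [h1 _ (coordNeZero_mk_homogenize 1 _), affineCoordComplex_mk_homogenize]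

end LimitEmbeddedSphere

/-- **Limits of partners are partners** (registered helper `helper_limitEmbeddedSpherePartnerClosed`):
for a continuous two-chart pair `(u, v)`, `v z = u z⁻¹` off `0`, injective on `ball t ρ`, if `tₖ → t`
and every `tₖ` has a partner — a parameter `s ≠ tₖ` with `u s = u tₖ`, or the point at infinity
`v 0 = u tₖ` — then `t` has a partner.  Infinitely many partners at infinity pass to the limit by
continuity; bounded finite partners subconverge to `s⋆` with `u s⋆ = u t`, and `s⋆ ≠ t` because `u` is
injective near `t`; unbounded ones are inverted, `wₖ = sₖ⁻¹ → w⋆` with `v w⋆ = u t`, giving the partner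
at infinity (`w⋆ = 0`) or the finite partner `w⋆⁻¹`, of norm `> ‖t‖`. [folklore] -/
theorem helper_limitEmbeddedSpherePartnerClosed : ∀ (X : Type) [TopologicalSpace X] [T2Space X] (u v : ℂ → X) (t : ℂ) (ρ : ℝ) (tk : ℕ → ℂ), Continuous u → Continuous v → (∀ z : ℂ, z ≠ 0 → v z = u z⁻¹) → 0 < ρ → Set.InjOn u (Metric.ball t ρ) → (∀ k, (∃ s, s ≠ tk k ∧ u s = u (tk k)) ∨ v 0 = u (tk k)) → Filter.Tendsto tk Filter.atTop (nhds t) → (∃ s, s ≠ t ∧ u s = u t) ∨ v 0 = u t := by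
  intro X _ _ u v t ρ tk hcontu hcontv huv hρ hinj htkN htk
  by_cases hfr : ∃ᶠ k in atTop, v 0 = u (tk k)
  · -- infinitely many partners at infinity: the closed condition passes to the limit
    right
    obtain ⟨φ, hφ, hφp⟩ := Filter.extraction_of_frequently_atTop hfr
    have h1 : Tendsto (fun k => u (tk (φ k))) atTop (𝓝 (u t)) :=
      (hcontu.tendsto _).comp (htk.comp hφ.tendsto_atTop)
    have h2 : (fun k => u (tk (φ k))) = fun _ => v 0 := funext fun k => (hφp k).symm
    rw [h2] at h1
    exact tendsto_nhds_unique tendsto_const_nhds h1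
  · -- eventually finite partners `sk k ≠ tk (k + K)` with the same image
    have hev : ∀ᶠ k in atTop, ∃ s, s ≠ tk k ∧ u s = u (tk k) := by
      filter_upwards [Filter.not_frequently.1 hfr] with k hk
      exact (htkN k).resolve_right hk
    obtain ⟨K, hK⟩ := Filter.eventually_atTop.1 hev
    choose sk hsk using fun k => hK (k + K) (Nat.le_add_left K k)
    have htk' : Tendsto (fun k => tk (k + K)) atTop (𝓝 t) := htk.comp (tendsto_add_atTop_nat K)
    set R : ℝ := ‖t‖ + 1 with hRdef
    have hRpos : 0 < R := by positivity
    by_cases hbd : ∃ᶠ k in atTop, ‖sk k‖ ≤ R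
    · -- bounded partners subconverge to `s⋆` with `u s⋆ = u t`; `s⋆ ≠ t` by local injectivity
      obtain ⟨φ, hφ, hφp⟩ := Filter.extraction_of_frequently_atTop hbd
      have hmem : ∀ k, sk (φ k) ∈ Metric.closedBall (0 : ℂ) R := fun k =>
        mem_closedBall_zero_iff.2 (hφp k)
      obtain ⟨sstar, -, ψ, hψ, hlimψ⟩ := (isCompact_closedBall (0 : ℂ) R).tendsto_subseq hmem
      have htk'' : Tendsto (fun k => tk (φ (ψ k) + K)) atTop (𝓝 t) :=
        htk'.comp ((hφ.comp hψ).tendsto_atTop)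
      have hG1 : Tendsto (fun k => u (sk (φ (ψ k)))) atTop (𝓝 (u sstar)) :=
        (hcontu.tendsto _).comp hlimψ
      have hG2 : Tendsto (fun k => u (tk (φ (ψ k) + K))) atTop (𝓝 (u t)) :=
        (hcontu.tendsto _).comp htk''
      have heqf : (fun k => u (sk (φ (ψ k)))) = fun k => u (tk (φ (ψ k) + K)) :=
        funext fun k => (hsk (φ (ψ k))).2
      rw [heqf] at hG1
      have hGeq : u sstar = u t := tendsto_nhds_unique hG1 hG2
      by_cases hst : sstar = t
      · exfalso
        have h1 : ∀ᶠ k in atTop, sk (φ (ψ k)) ∈ Metric.ball t ρ := by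
          rw [← hst]; exact hlimψ (Metric.ball_mem_nhds _ hρ)
        have h2 : ∀ᶠ k in atTop, tk (φ (ψ k) + K) ∈ Metric.ball t ρ :=
          htk'' (Metric.ball_mem_nhds _ hρ)
        obtain ⟨k, hk1, hk2⟩ := (h1.and h2).exists
        exact (hsk (φ (ψ k))).1 (hinj hk1 hk2 (hsk (φ (ψ k))).2)
      · exact Or.inl ⟨sstar, hst, hGeq⟩
    · -- the partners escape every disc: invert them and subconverge near the point at infinity
      obtain ⟨K2, hK2⟩ := Filter.eventually_atTop.1 (Filter.not_frequently.1 hbd)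
      have hbig : ∀ k, R < ‖sk (k + K2)‖ := fun k =>
        lt_of_not_ge (hK2 (k + K2) (Nat.le_add_left K2 k))
      have hsk0 : ∀ k, sk (k + K2) ≠ 0 := fun k h => by
        have := hbig k
        rw [h, norm_zero] at this
        linarith
      set wk : ℕ → ℂ := fun k => (sk (k + K2))⁻¹ with hwk
      have hwmem : ∀ k, wk k ∈ Metric.closedBall (0 : ℂ) R⁻¹ := fun k => by
        rw [mem_closedBall_zero_iff, hwk, norm_inv]
        exact inv_anti₀ hRpos (hbig k).le
      obtain ⟨wstar, hwstar, ψ, hψ, hlimψ⟩ :=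
        (isCompact_closedBall (0 : ℂ) R⁻¹).tendsto_subseq hwmem
      have hvw : ∀ k, v (wk k) = u (tk (k + K2 + K)) := fun k => by
        rw [hwk, huv _ (inv_ne_zero (hsk0 k)), inv_inv]
        exact (hsk (k + K2)).2
      have htk'' : Tendsto (fun k => tk (ψ k + K2 + K)) atTop (𝓝 t) :=
        htk'.comp ((tendsto_add_atTop_nat K2).comp hψ.tendsto_atTop)
      have hG1 : Tendsto (fun k => v (wk (ψ k))) atTop (𝓝 (v wstar)) :=
        (hcontv.tendsto _).comp hlimψ
      have hG2 : Tendsto (fun k => u (tk (ψ k + K2 + K))) atTop (𝓝 (u t)) :=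
        (hcontu.tendsto _).comp htk''
      have heqf : (fun k => v (wk (ψ k))) = fun k => u (tk (ψ k + K2 + K)) :=
        funext fun k => hvw (ψ k)
      rw [heqf] at hG1
      have hGeq : v wstar = u t := tendsto_nhds_unique hG1 hG2
      by_cases hw0 : wstar = 0
      · right
        rw [hw0] at hGeq
        exact hGeq
      · left
        refine ⟨wstar⁻¹, ?_, by rw [← huv wstar hw0]; exact hGeq⟩
        intro h
        have h1 : ‖wstar‖ ≤ R⁻¹ := mem_closedBall_zero_iff.1 hwstar
        have h2 : R ≤ ‖wstar⁻¹‖ := by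
          rw [norm_inv]
          exact (le_inv_comm₀ (norm_pos_iff.2 hw0) hRpos).1 h1
        rw [h] at h2
        linarith

/-- **A non-empty subset of `ℂ` containing a punctured neighbourhood of every point of the plane is
preconnected** (registered helper `helper_limitEmbeddedSphereRegularPreconnected`): its complement meets
every closed disc in a finite set (compactness and the punctured neighbourhoods), and a disc minus finitely
many points is path connected (`isPathConnected_ball_diff_finite`), so any two of its points are joined
inside it.  Used for the regular set of a `J`-holomorphic curve (critical points are isolated, McDuff 1991
Lemma 2.7). [folklore] -/
theorem helper_limitEmbeddedSphereRegularPreconnected : ∀ (R : Set ℂ), (∀ c : ℂ, ∀ᶠ z in nhdsWithin c {c}ᶜ, z ∈ R) → R.Nonempty → IsPreconnected R := by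
  intro R hCI hne
  -- `R` is open
  have hRopen : IsOpen R := by
    rw [isOpen_iff_mem_nhds]
    intro t ht
    have h := eventually_nhdsWithin_iff.1 (hCI t)
    filter_upwards [h] with z hz
    by_cases hzt : z = t
    · rw [hzt]; exact ht
    · exact hz hzt
  -- the complement meets every closed disc in a finite set
  have hZfin : ∀ r : ℝ, {c | c ∈ Metric.closedBall (0 : ℂ) r ∧ c ∉ R}.Finite := by
    intro r
    have hZccl : IsClosed {c | c ∈ Metric.closedBall (0 : ℂ) r ∧ c ∉ R} :=
      Metric.isClosed_closedBall.inter hRopen.isClosed_compl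
    have hZcK : IsCompact {c | c ∈ Metric.closedBall (0 : ℂ) r ∧ c ∉ R} :=
      (isCompact_closedBall (0 : ℂ) r).of_isClosed_subset hZccl fun c hc => hc.1
    set U : ℂ → Set ℂ := fun c => {z | z ≠ c → z ∈ R} with hUdef
    have hU : ∀ c ∈ {c | c ∈ Metric.closedBall (0 : ℂ) r ∧ c ∉ R}, U c ∈ 𝓝 c :=
      fun c _ => eventually_nhdsWithin_iff.1 (hCI c)
    obtain ⟨tfin, -, hcover⟩ := hZcK.elim_nhds_subcover U hU
    refine tfin.finite_toSet.subset fun c hc => ?_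
    obtain ⟨x, hx, hcx⟩ := Set.mem_iUnion₂.1 (hcover hc)
    have hcx' : c = x := by
      by_contra h
      exact hc.2 (hcx h)
    rw [hcx']
    exact hx
  -- any two points of `R` are joined inside `R`
  have key : ∀ a ∈ R, ∀ b ∈ R, JoinedIn R a b := by
    intro a ha b hb
    set r : ℝ := max ‖a‖ ‖b‖ + 1 with hrdef
    have hr : 0 < r := by positivity
    have hsub : Metric.ball (0 : ℂ) r \ {c | c ∈ Metric.closedBall (0 : ℂ) r ∧ c ∉ R} ⊆ R := by
      rintro x ⟨hx, hxZ⟩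
      by_contra hni
      exact hxZ ⟨Metric.ball_subset_closedBall hx, hni⟩
    have hpc := isPathConnected_ball_diff_finite hr (hZfin r)
    have haM : a ∈ Metric.ball (0 : ℂ) r \ {c | c ∈ Metric.closedBall (0 : ℂ) r ∧ c ∉ R} :=
      ⟨mem_ball_zero_iff.2 (by linarith [le_max_left ‖a‖ ‖b‖]), fun h => h.2 ha⟩
    have hbM : b ∈ Metric.ball (0 : ℂ) r \ {c | c ∈ Metric.closedBall (0 : ℂ) r ∧ c ∉ R} :=
      ⟨mem_ball_zero_iff.2 (by linarith [le_max_right ‖a‖ ‖b‖]), fun h => h.2 hb⟩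
    exact (hpc.joinedIn a haM b hbM).mono hsub
  exact (isPathConnected_iff.2 ⟨hne, key⟩).isConnected.isPreconnected

end Summit.SmoothPoincare4.SmoothPoincare4.Theorems.GromovRecognitionRelEnd.CrossCapLaurent

end
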